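import Literature.MathematicalPhysics.QuantumFieldTheory.Balaban1983to89.B9CubeLettersOpsL0
import Literature.MathematicalPhysics.QuantumFieldTheory.Balaban1983to89.B9CubeCoarsening
import Literature.MathematicalPhysics.QuantumFieldTheory.Balaban1983to89.Node00.OpsYLocalInverseAgree

/-!
# `Balaban1983to89.B9Cor36GpCubeLocLetter` — THE LOCALISED, TRANSPORTED CUBE LETTER `O_□ = χ·R(u)⁻¹G′_□(Ṽ)R(u)·χ` OF [B9] COR. 3.6 ∕ SECT. C IN THE
# CELL's (R)-DESIGN, AND ITS TWO LOCAL-INVERSE LAWS `h_□Δ′_a(U)O_□h_□ = h_□² = h_□O_□Δ′_a(U)h_□` — the per-cube displayed inputs `hloc` ∕ `hlocT` of p21's M5.5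
# FILE 6 `B9Thm37GpTorusRegularFinal.eBlock_kernelFamilySInv_Gp_of_localInverse` DISCHARGED to pointwise agreement data (sub-row G-B9-LETTERS, module M5.1b-G′, FILE 2)

T. Bałaban, *Propagators for lattice gauge theories in a background field*, Commun. Math. Phys. **99** (1985) 389–434
[`Balaban1985BackgroundPropagators`, "B9"]; [4] = T. Bałaban, *Propagators and renormalization transformations for lattice gauge
theories. II*, Commun. Math. Phys. **96** (1984) 223–250 [`Balaban1984PropagatorsII`].

statement-level skeleton of published theorems with citation tags; proofs where landed; nothing here is a claim about the
Yang–Mills mass gap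

THE PRINTED LOCUS (verbatim, held `paper:balaban1985-cmp99-background-propagators`, journal page = PDF page + 388; page owner r06 g67, HOME∕INBOX
2026-08-28T10:46:38Z).  Cor. 3.6 p. 408 l. 7–9: *«If a configuration U satisfies (3.35) with O(1)Mα₀ ≦ a₁, and Ω′₀ ⊂ □ for a cube □ of the class described in this
condition, then Theorems 3.1-3.3 hold for the operators G′(U), (Q′(U)G′²(U)Q′\*(U))⁻¹, G(U) constructed for the sequence {Ω′_j}»*; its proof p. 408 l. 3–6, 11–14:
*«Applying the gauge transformation u we get U′ = U^u = e^{iηA} with A satisfying the inequalities in (3.35) for j = k. This implies that U′ satisfies (3.37) for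
the sequence {Ω′_j} with U = 1 and α₁ = O(1)Mα₀ … but all the results of these theorems are gauge invariant, so they hold for the configuration U also»*;
Sect. C p. 408 l. 36–44, p. 409 l. 1–5: *«the sequence {Ω_n(□)} satisfies the assumptions of Corollary 3.6. The operators constructed for this sequence, which we
denote by G′_□(U), … satisfy all the inequalities of Theorems 3.1–3.3 correspondingly»*; (3.87)–(3.88) p. 409: *«G′₀ = Σ_□ h_□G′_□h_□ … Δ′_aG′₀ = I −
Σ_□ K(h_□)G′_□h_□»* — which uses `Δ′_aG′_□h_□ = h_□` on `supp h_□`; p. 410 l. 14–15: *«G′_□ depends on U restricted to Ω₀(□) ⊂ □̃⁵»*; (3.28)–(3.33) pp. 395–396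
(gauge covariance, «G′(U^u) = R(u)G′(U)R(u⁻¹)»).

WHY THIS FILE (cell `lit-balaban`, sub-row G-B9-LETTERS; module M5.1b-G′ «Cor 3.5∕3.6 for the SITE-sector cube letter G′_□» booked → p33 g96 by the map owner r06 g67,
`lit-balaban-r06/B9-LETTERS-MAP.md` §8 800883c21f89ddb2; design of record `lit-balaban-p33/COR35GP-STATEMENTS-p33.md` §1, afa1ae3d5c7fee1e).  p21's M5.5 FILE 6 takes, per
cover cube `□`, a cube letter `O_□ : SiteOpY 𝔸 i` with THREE displayed laws at the background `U₁`: `hloc : h_□·Δ′_a(U₁)·O_□(U₁)·h_□ = h_□²`, `hlocT : h_□·O_□(U₁)·Δ′_a(U₁)·h_□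
= h_□²` and the (3.42) block `hE` (read first-hand, :115–:147: nothing else is asked of `O_□` — no covariance, no law in `U`).  Print's `G′_□(U)` is the DIRICHLET operator of the
sequence `{Ω_n(□)}` and reads `U` on `Ω₀(□) ⊂ □̃⁵` only, where the (3.35) gauge `u` of ONE class cube makes `U^u = e^{iηA}` (3.37)-small; the cell's (R)-letter
`B9CubeLettersOpsL0.deltaPrimeACubeY i □ par V` (mass floor instead of the Dirichlet exterior, `B9-LETTERS-MAP.md` §9 (a) Q1) reads `V` on the whole member torus, where
`U^u` is NOT small (FINDING (F1) of the design memo, CONFIRMED on the print side by r06 g67 10:46:38Z).  The (R)-twin of print's construction is therefore: read the cube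
letter at a LOCALISED field `Ṽ` which AGREES WITH `U^u` NEAR `□` (on the rows that (3.88) and FILE 6 ever use) and is globally (3.37)-small, transport it back along `u`
(print: «all the results of these theorems are gauge invariant»), and cut it off near `□`:
  `O_□ := M_χ ∘ R(u)⁻¹ ∘ G′_□(Ṽ) ∘ R(u) ∘ M_χ`   (`locLetterY`; `M_χ = cutMulY χ`, `R(u) = conjY (gSiteY i u)`, `G′_□ = GpCubeY i □ parS`).
THIS FILE proves the two LOCAL-INVERSE LAWS of `O_□` against def-Y's genuine `Δ′_a(U)` (`Node00.deltaPrimeAY`) from POINTWISE data only — a finite set `D` of sites containing the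
stencil-thickening of `supp h` (`hD`), lying near `□` (`hnear`, r05's `NearH`, where the rows of `Δ′_a` and `Δ′_{a,□}` coincide), on whose stencils `χ = 1` (`hχ`), and on which
`U^u` and `Ṽ` AGREE in def-Y's sense `Node00.OpsYLocalInverseAgree.AgreeNearY` (bonds at the sites of `D` and the taxi runs of their averaging pairs) — plus invertibility of
`Δ′_{a,□}(Ṽ)` and the two transporter laws of record (`IsGaugeLawS`, `ParLocalY`; both ✓ for `parSymY` in the tree).  The (3.42) block `hE` of `O_□` (Sect. B at `Ṽ` + Leibniz
through `χ`) is FILES 3–6 of the module; the geometric discharge of `hD`∕`hnear`∕`hχ`∕`hagree` for the cut-offs of record (`hTY i □`, r05 `B9CubeCutoffNearH.nearH_of_hT`) is FILE 3.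
* §1 ROW LOCALITY: `deltaPrimeAY_apply_congr_stencil` (a row of `Δ′_a(U)` reads its input on p38's `stencilY` only), `mem_stencilY_of_avgCoeffCubeY_ne_zero` (the cube
  sequence's averaging pairs are averaging pairs of the member — blocks nest, r05 `B9CubeCoarsening`), `deltaPrimeACubeY_apply_congr_stencil`, `…_eq_zero_of_stencil`.
* §2 THE TWO ROW IDENTITIES behind (3.88) at the localised field: ★ `cutMulY_deltaPrimeAY_cutMulY_eq` (`M_h·Δ′_a(U′)·M_χ = M_h·Δ′_{a,□}(Ṽ)`) and ★ `cutMulY_deltaPrimeAY_cutMulY_eq'`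
  (`M_χ·Δ′_a(U′)·M_h = Δ′_{a,□}(Ṽ)·M_h`) from `hD`∕`hnear`∕`hχ` and the row agreement `Δ′_a(U′)λ(z) = Δ′_a(Ṽ)λ(z)`, `z ∈ D` (def-Y `deltaPrimeAY_apply_congr_of_parLocalY`).
* §3 THE LETTER `locLetterY` and ★★ `cutMulY_deltaPrimeAY_locLetterY_cutMulY` (`hloc`), ★★ `cutMulY_locLetterY_deltaPrimeAY_cutMulY` (`hlocT`) — by (3.31)–(3.32) covariance
  of `Δ′_a` (`Node00.OpsYGauge.deltaPrimeAY_cov`), `R(u)M_χ = M_χR(u)` (p38 `intw_cutMulY`), §2, and `Δ′_{a,□}(Ṽ)G′_□(Ṽ) = 1 = G′_□(Ṽ)Δ′_{a,□}(Ṽ)` (r05, under `IsUnit`);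
  ★★ `localInverse_laws_of_agree` packages both from the pointwise data.

HONEST SCOPE.  Finite-dimensional operator algebra over def-Y's and r05's DEFINED operators; the letter `O_□` is the (R)-design's reading of print's `G′_□(U)` («constructed for
the sequence {Ω_n(□)}», read at the field localised to a class cube — print's `U′ = U^u` on `Ω₀(□)`, p. 408 l. 11–14 — and transported back along `u`; print's Dirichlet
letter needs no localisation and no cut-off), a function of the CHOSEN gauge `u`, the CHOSEN localised field `Ṽ` and the CHOSEN cut-off `χ`: it is NOT gauge-covariant and is
NOT routed through M5.2's `thms31to33_cube_of_reg335` (r06 caution (i), 10:46:38Z).  DESIGN DEVIATION (FINDING (F2) of the memo, CONFIRMED on the print side by r06 g67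
11:03:47Z): print builds `{Ω_n(□)}` at a SMALL scale pair `(R₀, M₀)`, `M = KR₀M₀` (p. 408 l. 29–35), so that «Ω₀(□) ⊂ □̃⁵» ⊂ ONE class cube of (3.35) («O(1) … can be taken as
equal to 12», p. 409 l. 1–3); the cell's `B9CubeSequence408.cubeFam` is built at the member's `(R, M)` and its multiscale region is NOT contained in a typed class cube
(`IsCube396`: `n ≤ 10` big blocks) — HERE the cut-off `χ` (and the localised field, FILE 3) replace that containment.  NO estimate of [B9] is proved or used ((3.42) for `O_□` is FILES 3–6); `IsUnit
Δ′_{a,□}(Ṽ)`, `AgreeNearY`, `NearH`, the stencil conditions are HYPOTHESES here (inhabited: at `parS := parSymY`, `u := 1`, `Ṽ := U`, `χ := 1`, `D :=` the NearH sites,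
they reduce to r05's row agreement — not a vacuous schema); count-neutral; no summit ∕ sub-problem statement is proved; nothing continuum ∕ OS ∕ mass-gap ∕ Clay.  No
`sorry`, no `axiom`, no `… : Prop` fact, no `instance`, no `notation`.  NEW file; nothing landed is modified.  Cell `lit-balaban`, seat `lit-balaban-p33` gen 96,
2026-08-28; `--supports stmt-QuantumFields-19200` as helper.  Net new unproved facts: 0.

RELATED IN THE TREE, NOT DUPLICATED (searched 2026-08-28): def-Y's DIRICHLET local inverses `Node00.OpsYLocalInverse.GsqY` (compression of `Δ′_a(U)` to a site set; its
local-inverse law `cutMulY_deltaPrimeAY_GsqY_cutMulY` and `U`-locality `GsqY_congr_of_agree`) are the print-shaped ALTERNATIVE letters — they carry no flat (3.42) input in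
the tree (the `…L0` lineage ∕ M5.1a estimate r05's mass-floor letter, ruling (R)), hence are not the letters of this module; their agreement vocabulary
(`Node00.OpsYLocalInverseAgree.AgreeNearY ∕ ParLocalY ∕ deltaPrimeAY_apply_congr_of_parLocalY ∕ parLocalY_parSymY`) IS used by name.  r05 `B9CubeLettersOpsL0`
(`deltaPrimeACubeY`, `GpCubeY`, `deltaPrimeACubeY_apply_eq_of_nearH`, inverse laws), `B9CubeCoarsening.blkOf_eq_of_cube_blkOf_eq`, `B9CubeSequence408.NearH`; p38
`B9Thm37CubeCoverCommutators` (`cutMulY`, `stencilY`, `intw_cutMulY`); def-Y `Node00.OpsYGauge` (`conjY`, `gSiteY`, `gaugeY`, `IsGaugeLawS`, `deltaPrimeAY_cov`),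
`Node00.OpsYDeltaPrimeA` (`deltaPrimeAY_apply`); n06-j `B9Thm311DeltaPrimeSymm.avgCoeffY_eq_ite` — USED BY NAME; no existing module modified.
-/

noncomputable section

namespace Literature.MathematicalPhysics.QuantumFieldTheory.Balaban1983to89.B9Cor36GpCubeLocLetter

open Literature.MathematicalPhysics.QuantumFieldTheory.Balaban1983to89.B9Eq39Adjoint (R R_smul)
open Literature.MathematicalPhysics.QuantumFieldTheory.Balaban1983to89.B6KLevelCensusIndexV1 (KIdx)
open Literature.MathematicalPhysics.QuantumFieldTheory.Balaban1983to89.B6Cover236MultiLevelBlocks (cubes)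
open Literature.MathematicalPhysics.QuantumFieldTheory.Balaban1983to89.B6Geom246MultiLevelBox (blkOf blkOf_eq_iff_blk)
open Literature.MathematicalPhysics.QuantumFieldTheory.Balaban1983to89.B4Reflection242 (avgK blk)
open Literature.MathematicalPhysics.QuantumFieldTheory.Balaban1983to89.B6MultiLevelBoxOperator (levC levC_pos aPrinted)
open Literature.MathematicalPhysics.QuantumFieldTheory.Balaban1983to89.B6Prop23KLevelTorusCensus (aPrinted_pos)
open Literature.MathematicalPhysics.QuantumFieldTheory.Balaban1983to89.B9CubeSequence408 (NearH)
open Literature.MathematicalPhysics.QuantumFieldTheory.Balaban1983to89.B9CubeCoarsening (blkOf_eq_of_cube_blkOf_eq)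
open Literature.MathematicalPhysics.QuantumFieldTheory.Balaban1983to89.B9CubeLettersOpsL0 (cubeFamY levCubeY avgCoeffCubeY avgTrCubeY deltaPrimeACubeY GpCubeY
  deltaPrimeACubeY_apply deltaPrimeACubeY_apply_eq_of_nearH deltaPrimeACubeY_mul_GpCubeY GpCubeY_mul_deltaPrimeACubeY)
open Literature.MathematicalPhysics.QuantumFieldTheory.Balaban1983to89.B9Thm37CubeCoverCommutators (cutMulY cutMulY_apply cutMulY_mul stencilY self_mem_stencilY
  shiftY_mem_stencilY shiftY_symm_mem_stencilY mem_stencilY_of_avgCoeffY_ne_zero intw_cutMulY)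
open Literature.MathematicalPhysics.QuantumFieldTheory.Balaban1983to89.Node00 (SiteY CfgY SiteParY GaugeY UboxY shiftY lapS cdS cdsS avgCoeffY avgTrY levY deltaPrimeAY
  deltaPrimeAY_apply conjY conjY_mul conjY_one gSiteY gaugeY IsGaugeLawS Intw deltaPrimeAY_cov toKT)
open Literature.MathematicalPhysics.QuantumFieldTheory.Balaban1983to89.Node00.OpsYLocalInverseAgree (AgreeNearY ParLocalY deltaPrimeAY_apply_congr_of_parLocalY
  parLocalY_parSymY)

variable {d ℓ : ℕ} {hd : 1 ≤ d + 1} {hL : Odd (ℓ + 1) ∧ 1 < ℓ + 1} {b₀ b₁ : ℝ}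
variable {𝔸 : Type} [NormedRing 𝔸] [NormedAlgebra ℂ 𝔸] [CompleteSpace 𝔸]

/-! ## §1 Row locality of `Δ′_a(U)` and of the cube letter `Δ′_{a,□}(V)` in the input function -/

section Stencil

variable (i : KIdx d ℓ hd hL b₀ b₁) (q : ↥(cubes (toKT i).D.toDomains)) (par : SiteParY 𝔸 i)

/-- **A ROW OF def-Y's `Δ′_a(U)` READS ITS INPUT ON p38's STENCIL ONLY**: if `Λ = Λ′` on `stencilY i z` (the site, its `2(d+1)` neighbours, its block of `𝔅`), then
`(Δ′_a(U)Λ)(z) = (Δ′_a(U)Λ′)(z)` (the `Δ′_a`-twin of p38's `KhY_apply_congr`). [cite: Balaban1985BackgroundPropagators, (3.24) p.394, (3.88) p.409, p.410 («semi-local»)] -/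
theorem deltaPrimeAY_apply_congr_stencil (U : CfgY 𝔸 i) {Λ Λ' : SiteY i → 𝔸} (z : SiteY i) (hΛ : ∀ w ∈ stencilY i z, Λ w = Λ' w) :
    deltaPrimeAY i par U Λ z = deltaPrimeAY i par U Λ' z := by
  rw [deltaPrimeAY_apply, deltaPrimeAY_apply]
  have h0 : Λ z = Λ' z := hΛ _ (self_mem_stencilY i z)
  have h1 : ∀ μ : Fin (d + 1), Λ (shiftY i μ z) = Λ' (shiftY i μ z) := fun μ => hΛ _ (shiftY_mem_stencilY i z μ)
  have h2 : ∀ μ : Fin (d + 1), Λ ((shiftY i μ).symm z) = Λ' ((shiftY i μ).symm z) := fun μ => hΛ _ (shiftY_symm_mem_stencilY i z μ)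
  have h3 : ∀ w, ((avgCoeffY i z w : ℝ) : ℂ) • R (avgTrY i par U z w) (Λ w) = ((avgCoeffY i z w : ℝ) : ℂ) • R (avgTrY i par U z w) (Λ' w) := fun w => by
    by_cases hw : avgCoeffY i z w = 0
    · rw [hw, Complex.ofReal_zero, zero_smul, zero_smul]
    · rw [hΛ _ (mem_stencilY_of_avgCoeffY_ne_zero i z w hw)]
  have hlap : lapS i U Λ z = lapS i U Λ' z := by
    simp only [lapS, cdsS, cdS, B9Eq39Adjoint.covD, B9Eq39Adjoint.covDstar, Equiv.apply_symm_apply, h0, h1, h2]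
  rw [hlap]
  exact congrArg _ (Finset.sum_congr rfl fun w _ => h3 w)

omit [NormedRing 𝔸] [NormedAlgebra ℂ 𝔸] [CompleteSpace 𝔸] in
/-- **THE CUBE SEQUENCE's AVERAGING PAIRS ARE AVERAGING PAIRS OF THE MEMBER**: `avgCoeffCubeY i □ z w ≠ 0 ⟹ w ∈ stencilY i z` — the cube block of `z` lies in the member's
block of `z` (blocks nest, r05 `B9CubeCoarsening.blkOf_eq_of_cube_blkOf_eq`), on which the member's coefficient is the positive `levC_{lev z}`.
[cite: Balaban1985BackgroundPropagators, p.408 (the sequence {Ω_n(□)}), (3.24) p.394; Balaban1984PropagatorsII, (2.14) p.225, (2.45) p.231] -/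
theorem mem_stencilY_of_avgCoeffCubeY_ne_zero (z w : SiteY i) (hw : avgCoeffCubeY i q z w ≠ 0) : w ∈ stencilY i z := by
  refine mem_stencilY_of_avgCoeffY_ne_zero i z w ?_
  -- the cube coefficient is the cube block indicator, hence `w` and `z` share their cube block, hence their member block
  have hcube : B6Geom246MultiLevelBoxL0.blkOf (cubeFamY i q).toDomains w = B6Geom246MultiLevelBoxL0.blkOf (cubeFamY i q).toDomains z := by
    by_contra hne
    apply hw
    have hne' : ¬ blk ((ℓ + 1) ^ levCubeY i q z) w.1 = blk ((ℓ + 1) ^ levCubeY i q z) z.1 :=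
      fun hb => hne ((B6Geom246MultiLevelBoxL0.blkOf_eq_iff_blk (cubeFamY i q).toDomains).2 hb)
    unfold avgCoeffCubeY avgK
    rw [if_neg hne']
  have hmem : blkOf i.D.toDomains w = blkOf i.D.toDomains z := blkOf_eq_of_cube_blkOf_eq hcube
  have hblk : blk ((ℓ + 1) ^ levY i z) w.1 = blk ((ℓ + 1) ^ levY i z) z.1 := (blkOf_eq_iff_blk i.D.toDomains).1 hmem
  have hℓ : 1 ≤ ℓ := by have := hL.2; omega
  have hlev : 1 ≤ levY i z := (toKT i).D.one_le_lev z.1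
  unfold avgCoeffY avgK
  rw [if_pos hblk]
  exact (levC_pos d ℓ (aPrinted_pos hℓ _ hlev)).ne'

/-- **A ROW OF r05's CUBE LETTER `Δ′_{a,□}(V)` READS ITS INPUT ON THE MEMBER's STENCIL ONLY** (its own stencil — the site, its neighbours, its cube block — is contained there).
[cite: Balaban1985BackgroundPropagators, (3.24) p.394, p.409 l.1–5, p.410 («semi-local»)] -/
theorem deltaPrimeACubeY_apply_congr_stencil (V : CfgY 𝔸 i) {Λ Λ' : SiteY i → 𝔸} (z : SiteY i) (hΛ : ∀ w ∈ stencilY i z, Λ w = Λ' w) :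
    deltaPrimeACubeY i q par V Λ z = deltaPrimeACubeY i q par V Λ' z := by
  rw [deltaPrimeACubeY_apply, deltaPrimeACubeY_apply]
  have h0 : Λ z = Λ' z := hΛ _ (self_mem_stencilY i z)
  have h1 : ∀ μ : Fin (d + 1), Λ (shiftY i μ z) = Λ' (shiftY i μ z) := fun μ => hΛ _ (shiftY_mem_stencilY i z μ)
  have h2 : ∀ μ : Fin (d + 1), Λ ((shiftY i μ).symm z) = Λ' ((shiftY i μ).symm z) := fun μ => hΛ _ (shiftY_symm_mem_stencilY i z μ)
  have h3 : ∀ w, ((avgCoeffCubeY i q z w : ℝ) : ℂ) • R (avgTrCubeY i q par V z w) (Λ w)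
      = ((avgCoeffCubeY i q z w : ℝ) : ℂ) • R (avgTrCubeY i q par V z w) (Λ' w) := fun w => by
    by_cases hw : avgCoeffCubeY i q z w = 0
    · rw [hw, Complex.ofReal_zero, zero_smul, zero_smul]
    · rw [hΛ _ (mem_stencilY_of_avgCoeffCubeY_ne_zero i q z w hw)]
  have hlap : lapS i V Λ z = lapS i V Λ' z := by
    simp only [lapS, cdsS, cdS, B9Eq39Adjoint.covD, B9Eq39Adjoint.covDstar, Equiv.apply_symm_apply, h0, h1, h2]
  rw [hlap]
  exact congrArg _ (Finset.sum_congr rfl fun w _ => h3 w)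

/-- a row of `Δ′_a(U)` vanishes on an input that vanishes on its stencil. [cite: Balaban1985BackgroundPropagators, (3.24) p.394, p.410 («semi-local»), bookkeeping] -/
theorem deltaPrimeAY_apply_eq_zero_of_stencil (U : CfgY 𝔸 i) {Λ : SiteY i → 𝔸} (z : SiteY i) (hΛ : ∀ w ∈ stencilY i z, Λ w = 0) :
    deltaPrimeAY i par U Λ z = 0 := by
  rw [deltaPrimeAY_apply_congr_stencil i par U z (Λ' := 0) (fun w hw => by rw [hΛ w hw]; rfl), map_zero, Pi.zero_apply]

/-- a row of the cube letter vanishes on an input that vanishes on the member's stencil. [cite: Balaban1985BackgroundPropagators, (3.24) p.394, p.409, bookkeeping] -/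
theorem deltaPrimeACubeY_apply_eq_zero_of_stencil (V : CfgY 𝔸 i) {Λ : SiteY i → 𝔸} (z : SiteY i) (hΛ : ∀ w ∈ stencilY i z, Λ w = 0) :
    deltaPrimeACubeY i q par V Λ z = 0 := by
  rw [deltaPrimeACubeY_apply_congr_stencil i q par V z (Λ' := 0) (fun w hw => by rw [hΛ w hw]; rfl), map_zero, Pi.zero_apply]

end Stencil

/-! ## §2 The two row identities behind (3.88) at the localised field -/

section Rows

variable (i : KIdx d ℓ hd hL b₀ b₁) (q : ↥(cubes (toKT i).D.toDomains)) (par : SiteParY 𝔸 i)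

/-- ★ **`M_h·Δ′_a(U′)·M_χ = M_h·Δ′_{a,□}(Ṽ)`** — on the rows of `supp h`: the cut-off `χ` is invisible (it is `1` on their stencils), the member's `Δ′_a` IS the cube letter there (r05's
row agreement near `□`), and `U′`, `Ṽ` give the same rows (pointwise agreement `hrow`).  Print: `Δ′_aG′_□h_□ = h_□` uses exactly these rows.
[cite: Balaban1985BackgroundPropagators, (3.88) p.409, (3.24) p.394, p.410 l.14–15] -/
theorem cutMulY_deltaPrimeAY_cutMulY_eq (U' V : CfgY 𝔸 i) (h χ : SiteY i → ℝ)
    (hχ : ∀ z, h z ≠ 0 → ∀ w ∈ stencilY i z, χ w = 1) (hnear : ∀ z, h z ≠ 0 → NearH q z.1)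
    (hrow : ∀ z, h z ≠ 0 → ∀ Λ, deltaPrimeAY i par U' Λ z = deltaPrimeAY i par V Λ z) :
    cutMulY h * deltaPrimeAY i par U' * cutMulY χ = cutMulY h * deltaPrimeACubeY i q par V := by
  refine LinearMap.ext fun Λ => funext fun z => ?_
  rw [Module.End.mul_apply, Module.End.mul_apply, Module.End.mul_apply, cutMulY_apply, cutMulY_apply]
  by_cases hz : h z = 0
  · rw [hz, Complex.ofReal_zero, zero_smul, zero_smul]
  · congr 1
    rw [deltaPrimeAY_apply_congr_stencil i par U' z (Λ' := Λ) (fun w hw => by rw [cutMulY_apply, hχ z hz w hw, Complex.ofReal_one, one_smul]),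
      hrow z hz, deltaPrimeACubeY_apply_eq_of_nearH i q par V Λ (hnear z hz)]

/-- ★ **`M_χ·Δ′_a(U′)·M_h = Δ′_{a,□}(Ṽ)·M_h`** — for the transposed law: a row of `Δ′_a(U′)·M_h` or of `Δ′_{a,□}(Ṽ)·M_h` at `z` vanishes unless the stencil of `z` meets `supp h`
(`hD`); on such rows `χ = 1` and the two operators agree as before. [cite: Balaban1985BackgroundPropagators, (3.88) p.409, (3.24) p.394, p.410 l.14–15] -/
theorem cutMulY_deltaPrimeAY_cutMulY_eq' (U' V : CfgY 𝔸 i) (h χ : SiteY i → ℝ) (D : Finset (SiteY i))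
    (hD : ∀ z w, w ∈ stencilY i z → h w ≠ 0 → z ∈ D) (hχ : ∀ z ∈ D, χ z = 1) (hnear : ∀ z ∈ D, NearH q z.1)
    (hrow : ∀ z ∈ D, ∀ Λ, deltaPrimeAY i par U' Λ z = deltaPrimeAY i par V Λ z) :
    cutMulY χ * deltaPrimeAY i par U' * cutMulY h = deltaPrimeACubeY i q par V * cutMulY h := by
  refine LinearMap.ext fun Λ => funext fun z => ?_
  rw [Module.End.mul_apply, Module.End.mul_apply, Module.End.mul_apply, cutMulY_apply]
  by_cases hz : z ∈ D
  · rw [hχ z hz, Complex.ofReal_one, one_smul, hrow z hz, deltaPrimeACubeY_apply_eq_of_nearH i q par V _ (hnear z hz)]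
  · -- the stencil of `z` misses `supp h`: both rows vanish on `h·Λ`
    have h0 : ∀ w ∈ stencilY i z, cutMulY h Λ w = 0 := fun w hw => by
      by_contra hne
      refine hz (hD z w hw fun hw0 => hne ?_)
      rw [cutMulY_apply, hw0, Complex.ofReal_zero, zero_smul]
    rw [deltaPrimeAY_apply_eq_zero_of_stencil i par U' z h0, deltaPrimeACubeY_apply_eq_zero_of_stencil i q par V z h0, smul_zero]

end Rows

/-! ## §3 The localised, transported, cut-off cube letter and its two local-inverse laws -/

section Letter

variable (i : KIdx d ℓ hd hL b₀ b₁) (q : ↥(cubes (toKT i).D.toDomains)) (parS : SiteParY 𝔸 i)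

/-- ★ **THE LOCALISED CUBE LETTER OF THE (R)-DESIGN**: `O_□ := M_χ ∘ R(u)⁻¹ ∘ G′_□(Ṽ) ∘ R(u) ∘ M_χ` — r05's cube Green's operator `G′_□ = (Δ′_{a,□})⁻¹` READ AT a field `Ṽ`
(meant: the (3.35)-gauged field `U^u`, localised to its class cube — print's «U′ = U^u = e^{iηA}» on `Ω₀(□)`), TRANSPORTED BACK along the gauge `u` (print: «all the results of
these theorems are gauge invariant, so they hold for the configuration U also») and CUT OFF by a scalar `χ` (`= 1` near `□`).  A function of the chosen `u`, `Ṽ`, `χ` — not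
gauge-covariant; print's Dirichlet `G′_□(U)` needs none of the three devices. [cite: Balaban1985BackgroundPropagators, Cor. 3.6 p.408 l.3–14, p.409 l.1–5 («G′_□(U)»), (3.33) p.396, (3.87) p.409] -/
def locLetterY (g : GaugeY 𝔸 i) (χ : SiteY i → ℝ) (V : CfgY 𝔸 i) : (SiteY i → 𝔸) →ₗ[ℂ] (SiteY i → 𝔸) :=
  cutMulY χ * conjY (gSiteY i g)⁻¹ * GpCubeY i q parS V * conjY (gSiteY i g) * cutMulY χ

/-- `O_□`, unfolded. [cite: Balaban1985BackgroundPropagators, p.409 l.1–5, bookkeeping] -/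
theorem locLetterY_def (g : GaugeY 𝔸 i) (χ : SiteY i → ℝ) (V : CfgY 𝔸 i) :
    locLetterY i q parS g χ V = cutMulY χ * conjY (gSiteY i g)⁻¹ * GpCubeY i q parS V * conjY (gSiteY i g) * cutMulY χ := rfl

omit [CompleteSpace 𝔸] in
/-- `R(u⁻¹)R(u) = 1` on the site carrier. [cite: Balaban1985BackgroundPropagators, (3.31) p.395, bookkeeping] -/
theorem conjY_inv_mul_conjY (γ : SiteY i → 𝔸ˣ) : (conjY γ⁻¹ : Module.End ℂ (SiteY i → 𝔸)) * conjY γ = 1 := by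
  rw [Module.End.mul_eq_comp, ← conjY_mul, inv_mul_cancel, conjY_one]; rfl

omit [CompleteSpace 𝔸] in
/-- `R(u)R(u⁻¹) = 1` on the site carrier. [cite: Balaban1985BackgroundPropagators, (3.31) p.395, bookkeeping] -/
theorem conjY_mul_conjY_inv (γ : SiteY i → 𝔸ˣ) : (conjY γ : Module.End ℂ (SiteY i → 𝔸)) * conjY γ⁻¹ = 1 := by
  rw [Module.End.mul_eq_comp, ← conjY_mul, mul_inv_cancel, conjY_one]; rfl

omit [CompleteSpace 𝔸] in
/-- `R(u)` commutes with a scalar cut-off (p38's `intw_cutMulY`, as a product identity). [cite: Balaban1985BackgroundPropagators, (3.28) p.395, (3.87) p.409, bookkeeping] -/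
theorem cutMulY_mul_conjY (γ : SiteY i → 𝔸ˣ) (χ : SiteY i → ℝ) :
    (cutMulY χ : Module.End ℂ (SiteY i → 𝔸)) * conjY γ = conjY γ * cutMulY χ :=
  intw_cutMulY γ χ

/-- **(3.31)–(3.32) AS A PRODUCT IDENTITY**: `Δ′_a(U) = R(u)⁻¹·Δ′_a(U^u)·R(u)` at a lawful site transporter. [cite: Balaban1985BackgroundPropagators, (3.31)–(3.32) p.395, (3.24) p.394] -/
theorem deltaPrimeAY_eq_conj {parS : SiteParY 𝔸 i} (hS : IsGaugeLawS i parS) (g : GaugeY 𝔸 i) (U : CfgY 𝔸 i) :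
    deltaPrimeAY i parS U = conjY (gSiteY i g)⁻¹ * deltaPrimeAY i parS (gaugeY i g U) * conjY (gSiteY i g) := by
  have hcov : deltaPrimeAY i parS (gaugeY i g U) * conjY (gSiteY i g) = conjY (gSiteY i g) * deltaPrimeAY i parS U := deltaPrimeAY_cov g U hS
  rw [mul_assoc, hcov, ← mul_assoc, conjY_inv_mul_conjY, one_mul]

/-- ★★ **THE LOCAL-INVERSE LAW `h·Δ′_a(U)·O_□·h = h²`** (p21's `hloc`; print's `Δ′_aG′_□h_□ = h_□` behind (3.88)) for the localised letter, from: the gauge law of `parS`, the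
row identity of §2 at `U′ = U^u`, `χ·h = h`, and `Δ′_{a,□}(Ṽ)G′_□(Ṽ) = 1`. [cite: Balaban1985BackgroundPropagators, (3.88) p.409, Cor. 3.6 p.408 l.11–14, (3.31)–(3.33) pp.395–396] -/
theorem cutMulY_deltaPrimeAY_locLetterY_cutMulY {parS : SiteParY 𝔸 i} (hS : IsGaugeLawS i parS) (g : GaugeY 𝔸 i) (U V : CfgY 𝔸 i) (h χ : SiteY i → ℝ)
    (hχh : ∀ z, χ z * h z = h z)
    (hrows : cutMulY h * deltaPrimeAY i parS (gaugeY i g U) * cutMulY χ = cutMulY h * deltaPrimeACubeY i q parS V)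
    (hunit : IsUnit (deltaPrimeACubeY i q parS V)) :
    cutMulY h * deltaPrimeAY i parS U * locLetterY i q parS g χ V * cutMulY h = cutMulY h * cutMulY h := by
  set Γ : Module.End ℂ (SiteY i → 𝔸) := conjY (gSiteY i g) with hΓ
  set Γi : Module.End ℂ (SiteY i → 𝔸) := conjY (gSiteY i g)⁻¹ with hΓi
  set H : Module.End ℂ (SiteY i → 𝔸) := cutMulY h with hH
  set C : Module.End ℂ (SiteY i → 𝔸) := cutMulY χ with hC
  set Δ' := deltaPrimeAY i parS (gaugeY i g U) with hΔ'
  set Δc := deltaPrimeACubeY i q parS V with hΔc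
  set G := GpCubeY i q parS V with hG
  have hCH : C * H = H := by
    rw [hC, hH, cutMulY_mul]; exact congrArg _ (funext hχh)
  have hΓC : Γ * C * Γi = C := by rw [hΓ, hC, hΓi, ← cutMulY_mul_conjY, mul_assoc, conjY_mul_conjY_inv, mul_one]
  have hHΓi : H * Γi = Γi * H := by rw [hH, hΓi, cutMulY_mul_conjY]
  have hΓH : Γ * H = H * Γ := by rw [hH, hΓ, cutMulY_mul_conjY]
  have hΔG : Δc * G = 1 := deltaPrimeACubeY_mul_GpCubeY i q parS V hunit
  rw [deltaPrimeAY_eq_conj i hS g U, locLetterY_def]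
  show H * (Γi * Δ' * Γ) * (C * Γi * G * Γ * C) * H = H * H
  calc H * (Γi * Δ' * Γ) * (C * Γi * G * Γ * C) * H
      = (H * Γi) * Δ' * (Γ * C * Γi) * G * Γ * (C * H) := by simp only [mul_assoc]
    _ = Γi * (H * Δ' * C) * G * Γ * H := by rw [hHΓi, hΓC, hCH]; simp only [mul_assoc]
    _ = Γi * (H * Δc) * G * Γ * H := by rw [hrows]
    _ = Γi * H * (Δc * G) * Γ * H := by simp only [mul_assoc]
    _ = Γi * (H * Γ) * H := by rw [hΔG, mul_one, mul_assoc Γi H Γ]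
    _ = (Γi * Γ) * H * H := by rw [← hΓH]; simp only [mul_assoc]
    _ = H * H := by rw [hΓi, hΓ, conjY_inv_mul_conjY, one_mul]

/-- ★★ **THE TRANSPOSED LOCAL-INVERSE LAW `h·O_□·Δ′_a(U)·h = h²`** (p21's `hlocT`) for the localised letter, from: the gauge law of `parS`, the transposed row identity of §2 at
`U′ = U^u`, `h·χ = h`, and `G′_□(Ṽ)Δ′_{a,□}(Ṽ) = 1`. [cite: Balaban1985BackgroundPropagators, (3.88) p.409, Cor. 3.6 p.408 l.11–14, (3.31)–(3.33) pp.395–396] -/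
theorem cutMulY_locLetterY_deltaPrimeAY_cutMulY {parS : SiteParY 𝔸 i} (hS : IsGaugeLawS i parS) (g : GaugeY 𝔸 i) (U V : CfgY 𝔸 i) (h χ : SiteY i → ℝ)
    (hχh : ∀ z, χ z * h z = h z)
    (hrows : cutMulY χ * deltaPrimeAY i parS (gaugeY i g U) * cutMulY h = deltaPrimeACubeY i q parS V * cutMulY h)
    (hunit : IsUnit (deltaPrimeACubeY i q parS V)) :
    cutMulY h * locLetterY i q parS g χ V * deltaPrimeAY i parS U * cutMulY h = cutMulY h * cutMulY h := by
  set Γ : Module.End ℂ (SiteY i → 𝔸) := conjY (gSiteY i g) with hΓ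
  set Γi : Module.End ℂ (SiteY i → 𝔸) := conjY (gSiteY i g)⁻¹ with hΓi
  set H : Module.End ℂ (SiteY i → 𝔸) := cutMulY h with hH
  set C : Module.End ℂ (SiteY i → 𝔸) := cutMulY χ with hC
  set Δ' := deltaPrimeAY i parS (gaugeY i g U) with hΔ'
  set Δc := deltaPrimeACubeY i q parS V with hΔc
  set G := GpCubeY i q parS V with hG
  have hHC : H * C = H := by
    rw [hC, hH, cutMulY_mul]; exact congrArg _ (funext fun z => by rw [mul_comm]; exact hχh z)
  have hΓC : Γ * C * Γi = C := by rw [hΓ, hC, hΓi, ← cutMulY_mul_conjY, mul_assoc, conjY_mul_conjY_inv, mul_one]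
  have hΓH : Γ * H = H * Γ := by rw [hH, hΓ, cutMulY_mul_conjY]
  have hHΓi : H * Γi = Γi * H := by rw [hH, hΓi, cutMulY_mul_conjY]
  have hGΔ : G * Δc = 1 := GpCubeY_mul_deltaPrimeACubeY i q parS V hunit
  rw [deltaPrimeAY_eq_conj i hS g U, locLetterY_def]
  show H * (C * Γi * G * Γ * C) * (Γi * Δ' * Γ) * H = H * H
  calc H * (C * Γi * G * Γ * C) * (Γi * Δ' * Γ) * H
      = (H * C) * Γi * G * (Γ * C * Γi) * Δ' * (Γ * H) := by simp only [mul_assoc]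
    _ = H * Γi * G * (C * Δ' * H) * Γ := by rw [hHC, hΓC, hΓH]; simp only [mul_assoc]
    _ = H * Γi * G * (Δc * H) * Γ := by rw [hrows]
    _ = H * Γi * (G * Δc) * H * Γ := by simp only [mul_assoc]
    _ = H * Γi * H * Γ := by rw [hGΔ, mul_one]
    _ = H * (H * Γi) * Γ := by rw [mul_assoc H Γi H, ← hHΓi]
    _ = H * H * (Γi * Γ) := by simp only [mul_assoc]
    _ = H * H := by rw [hΓi, hΓ, conjY_inv_mul_conjY, mul_one]

/-- ★★ **BOTH LOCAL-INVERSE LAWS OF `O_□` FROM POINTWISE AGREEMENT DATA** — the per-cube `hloc`∕`hlocT` of p21's FILE 6 for the localised letter: given a lawful, local site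
transporter (`IsGaugeLawS`, `ParLocalY` — def-Y's laws of record), a finite site set `D` containing every site whose stencil meets `supp h` (`hD`), near `□` (`hnear`), with `χ = 1`
on the stencils of its sites (`hχ`), on which `U^u` and `Ṽ` agree in def-Y's sense (`hagree`), and `Δ′_{a,□}(Ṽ)` invertible.
[cite: Balaban1985BackgroundPropagators, (3.88) p.409, Cor. 3.6 p.408 l.3–14, p.410 l.14–15, (3.31)–(3.33) pp.395–396] -/
theorem localInverse_laws_of_agree {parS : SiteParY 𝔸 i} (hS : IsGaugeLawS i parS) (hpar : ParLocalY i parS) (g : GaugeY 𝔸 i) (U V : CfgY 𝔸 i)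
    (h χ : SiteY i → ℝ) (D : Finset (SiteY i))
    (hD : ∀ z w, w ∈ stencilY i z → h w ≠ 0 → z ∈ D) (hnear : ∀ z ∈ D, NearH q z.1) (hχ : ∀ z ∈ D, ∀ w ∈ stencilY i z, χ w = 1)
    (hagree : AgreeNearY i D (gaugeY i g U) V) (hunit : IsUnit (deltaPrimeACubeY i q parS V)) :
    cutMulY h * deltaPrimeAY i parS U * locLetterY i q parS g χ V * cutMulY h = cutMulY h * cutMulY h ∧
    cutMulY h * locLetterY i q parS g χ V * deltaPrimeAY i parS U * cutMulY h = cutMulY h * cutMulY h := by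
  -- `supp h ⊂ D` (a site is in its own stencil), so `χ = 1` on `supp h`
  have hsupp : ∀ z, h z ≠ 0 → z ∈ D := fun z hz => hD z z (self_mem_stencilY i z) hz
  have hχh : ∀ z, χ z * h z = h z := fun z => by
    by_cases hz : h z = 0
    · rw [hz, mul_zero]
    · rw [hχ z (hsupp z hz) z (self_mem_stencilY i z), one_mul]
  have hrow : ∀ z ∈ D, ∀ Λ, deltaPrimeAY i parS (gaugeY i g U) Λ z = deltaPrimeAY i parS V Λ z :=
    fun z hz Λ => deltaPrimeAY_apply_congr_of_parLocalY hpar hagree Λ hz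
  refine ⟨cutMulY_deltaPrimeAY_locLetterY_cutMulY i q hS g U V h χ hχh ?_ hunit,
    cutMulY_locLetterY_deltaPrimeAY_cutMulY i q hS g U V h χ hχh ?_ hunit⟩
  · exact cutMulY_deltaPrimeAY_cutMulY_eq i q parS (gaugeY i g U) V h χ (fun z hz => hχ z (hsupp z hz)) (fun z hz => hnear z (hsupp z hz))
      (fun z hz => hrow z (hsupp z hz))
  · exact cutMulY_deltaPrimeAY_cutMulY_eq' i q parS (gaugeY i g U) V h χ D hD (fun z hz => hχ z hz z (self_mem_stencilY i z)) hnear hrow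

/-- ★★ the same at the record's symmetrised transporter `parSymY`, BOTH transporter laws discharged (def-Y `Node00.OpsYRecordV4.parSymY_isGaugeLawS`,
`Node00.OpsYLocalInverseAgree.parLocalY_parSymY`).
[cite: Balaban1985BackgroundPropagators, (3.88) p.409, Cor. 3.6 p.408, (3.40) p.397] -/
theorem localInverse_laws_of_agree_parSymY (g : GaugeY 𝔸 i) (U V : CfgY 𝔸 i)
    (h χ : SiteY i → ℝ) (D : Finset (SiteY i))
    (hD : ∀ z w, w ∈ stencilY i z → h w ≠ 0 → z ∈ D) (hnear : ∀ z ∈ D, NearH q z.1) (hχ : ∀ z ∈ D, ∀ w ∈ stencilY i z, χ w = 1)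
    (hagree : AgreeNearY i D (gaugeY i g U) V) (hunit : IsUnit (deltaPrimeACubeY i q (Node00.parSymY i) V)) :
    cutMulY h * deltaPrimeAY i (Node00.parSymY i) U * locLetterY i q (Node00.parSymY i) g χ V * cutMulY h = cutMulY h * cutMulY h ∧
    cutMulY h * locLetterY i q (Node00.parSymY i) g χ V * deltaPrimeAY i (Node00.parSymY i) U * cutMulY h = cutMulY h * cutMulY h :=
  localInverse_laws_of_agree i q (Node00.parSymY_isGaugeLawS i) (parLocalY_parSymY i) g U V h χ D hD hnear hχ hagree hunit

end Letter

end Literature.MathematicalPhysics.QuantumFieldTheory.Balaban1983to89.B9Cor36GpCubeLocLetter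

end
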